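import Literature.NumberTheory.QuadraticForms.TransferFormMeyer
import Literature.NumberTheory.QuadraticForms.TransferFormRealQuadraticSigns
import HarnessLib

/-!
# Proof of Bayer-Fluckiger–van Geemen–Schütt 2025, Cor. 11.4

(`E`-structures on rational forms of signature `(3, 2m - 3)` and determinant `-1`.)

Topic `Literature/NumberTheory/QuadraticForms`; namespace `Literature.NumberTheory.QuadraticForms`.
This file discharges the named fact `BFvGS2025_transfer_realQuadratic_of_det_neg_one`
(`TransferForm.lean`): for a real quadratic field `E`, `m` odd, `m ≥ 3`, `r₀ ∈ {2, 3}` and a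
rational diagonal form `U ≃ ⟨c⟩` with `3` positive and `2m - 3` negative weights and `-∏ cᵢ` a
square, there are `α₁, …, α_m ∈ E^×` and a real embedding `σ` with exactly `r₀` of the
`σ(αᵢ)` positive and `U ≃ T_E(⟨α₁, …, α_m⟩)`.

Proof (E. Bayer-Fluckiger, B. van Geemen, M. Schütt, arXiv:2511.19970, Cor. 11.4 ⇐ Cor. 11.3 ⇐
Thm. 11.2; the source argues in the Witt group with the transfer results of [BGS]; here the same
local–global input enters only through **Meyer's theorem** over `ℚ`, proved in this tree
(`MeyerRat.lean`), and the rest is explicit linear algebra):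

1. `E = ℚ(θ)`, `θ² = d > 0` a non-square, `σ(θ) = s > 0` (`exists_sqrt_generator`).
2. Carve `(m - 3)` blocks `⟨-1, -d⟩ = T⟨-1/2⟩` off the negative part (`exists_negCarve`), leaving
   `⟨c₊⟩ ⊥ ⟨n₀, n₁, n₂⟩` of rank `6` with `∏ c₊ ∏ n = -s'²` (`m` odd: `d^{m-3}` is a square).
3. The rank-`6` step (`exists_three_blocks`): `⟨c₊⟩ ⊥ ⟨n⟩ ≅ ⟨t₀, x₀⟩ ⊥ ⟨t₁, x₁⟩ ⊥ ⟨t₂, x₂⟩`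
   with `xᵢ ∈ tᵢ d N(E^×) ℚ^{×2}`, hence `⟨tᵢ, xᵢ⟩ ≅ T⟨βᵢ⟩` (`equivalent_pair_transfer_smul_sq`),
   `β₀` of mixed sign and `β₁, β₂` either both of mixed sign or `β₁ ≫ 0 ≫ β₂`; in the latter
   case re-diagonalise `⟨β₁, β₂⟩` over `E` into two blocks of mixed sign (`exists_mixed_pair`).
4. Replace each mixed `βᵢ` by its conjugate if necessary (`T⟨β⟩ ≅ T⟨β̄⟩`) so that
   `σ(βᵢ) > 0` for `i < r₀` and `σ(βᵢ) < 0` otherwise; the `m - 3` blocks `T⟨-1/2⟩` have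
   `σ(-1/2) < 0`. Then `U ≅ ⊥ᵢ T⟨αᵢ⟩ = T_E(⟨α⟩)` and exactly `r₀` of the `σ(αᵢ)` are positive.

## References

* [BayerFluckigerVanGeemenSchuett2025] E. Bayer-Fluckiger, B. van Geemen, M. Schütt,
  *Non-projective K3 surfaces with real or Salem multiplication*, arXiv:2511.19970, Thm. 11.2,
  Cor. 11.3, Cor. 11.4 (pp. 19–20 of the held text).
* J.-P. Serre, *A Course in Arithmetic*, GTM 7, Springer 1973, Ch. IV §3.2 Cor. 2 (Meyer).
  [Serre1973]
-/

namespace Literature.NumberTheory.QuadraticForms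

open QuadraticMap Module

/-- Signs of the transfer block `T⟨β⟩ ≅ ⟨t, x⟩`, `β = t/2 + (th/2g)θ`, `x = t d (g² - dh²) ρ²`, at
the real embeddings `θ ↦ ±s` (`s² = d`): `σ(β) σ̄(β) = N(β) = t x / (4 g² d ρ²)` and
`σ(β) + σ̄(β) = t`, so `β` is of mixed sign iff `t x < 0`, totally positive iff `t, x > 0`,
totally negative iff `t, x < 0`. [cite: BayerFluckigerVanGeemenSchuett2025, §10] -/
theorem transferBlock_signs {d : ℚ} (hd : 0 < d) {s : ℝ} (hsd : s ^ 2 = d) {t x g h ρ : ℚ}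
    (hg : g ≠ 0) (hρ : ρ ≠ 0) (hx : x = t * d * (g ^ 2 - d * h ^ 2) * ρ ^ 2) :
    (t * x < 0 → (((t / 2 : ℚ) : ℝ) + ((t * h / (2 * g) : ℚ) : ℝ) * s) *
        (((t / 2 : ℚ) : ℝ) - ((t * h / (2 * g) : ℚ) : ℝ) * s) < 0) ∧
    (0 < t → 0 < x → 0 < ((t / 2 : ℚ) : ℝ) + ((t * h / (2 * g) : ℚ) : ℝ) * s ∧
        0 < ((t / 2 : ℚ) : ℝ) - ((t * h / (2 * g) : ℚ) : ℝ) * s) ∧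
    (t < 0 → x < 0 → ((t / 2 : ℚ) : ℝ) + ((t * h / (2 * g) : ℚ) : ℝ) * s < 0 ∧
        ((t / 2 : ℚ) : ℝ) - ((t * h / (2 * g) : ℚ) : ℝ) * s < 0) := by
  have hP : (((t / 2 : ℚ) : ℝ) + ((t * h / (2 * g) : ℚ) : ℝ) * s) *
      (((t / 2 : ℚ) : ℝ) - ((t * h / (2 * g) : ℚ) : ℝ) * s) =
      ((t * x / (4 * g ^ 2 * d * ρ ^ 2) : ℚ) : ℝ) := by
    have e1 : ∀ a b : ℝ, (a + b * s) * (a - b * s) = a ^ 2 - b ^ 2 * s ^ 2 := fun a b => by ring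
    rw [e1, hsd]
    have e2 : (t / 2 : ℚ) ^ 2 - (t * h / (2 * g)) ^ 2 * d = t * x / (4 * g ^ 2 * d * ρ ^ 2) := by
      rw [hx, eq_div_iff (by positivity)]
      field_simp
      ring
    exact_mod_cast e2
  have hden : (0 : ℚ) < 4 * g ^ 2 * d * ρ ^ 2 := by positivity
  have hsum : (((t / 2 : ℚ) : ℝ) + ((t * h / (2 * g) : ℚ) : ℝ) * s) +
      (((t / 2 : ℚ) : ℝ) - ((t * h / (2 * g) : ℚ) : ℝ) * s) = t := by
    push_cast; ring
  refine ⟨fun htx => ?_, fun ht0 hx0 => ?_, fun ht0 hx0 => ?_⟩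
  · rw [hP]; exact_mod_cast div_neg_of_neg_of_pos htx hden
  · have hP' : 0 < (((t / 2 : ℚ) : ℝ) + ((t * h / (2 * g) : ℚ) : ℝ) * s) *
        (((t / 2 : ℚ) : ℝ) - ((t * h / (2 * g) : ℚ) : ℝ) * s) := by
      rw [hP]; exact_mod_cast div_pos (mul_pos ht0 hx0) hden
    have ht' : (0 : ℝ) < t := by exact_mod_cast ht0
    constructor <;> nlinarith
  · have hP' : 0 < (((t / 2 : ℚ) : ℝ) + ((t * h / (2 * g) : ℚ) : ℝ) * s) *
        (((t / 2 : ℚ) : ℝ) - ((t * h / (2 * g) : ℚ) : ℝ) * s) := by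
      rw [hP]; exact_mod_cast div_pos (mul_pos_of_neg_of_neg ht0 hx0) hden
    have ht' : (t : ℝ) < 0 := by exact_mod_cast ht0
    constructor <;> nlinarith

/-- Normalising the sign of a mixed block at `σ`: if `N(u + vθ) < 0` there is `v' = ±v` with
`σ(u + v'θ) > 0 > σ̄(u + v'θ)` and `T⟨u + vθ⟩ ≅ T⟨u + v'θ⟩`; and the opposite normalisation.
[cite: BayerFluckigerVanGeemenSchuett2025, Thm. 11.2] -/
theorem exists_conj_sign {E : Type*} [Field E] [Algebra ℚ E] {θ : E} {d : ℚ}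
    (hθ : θ * θ = algebraMap ℚ E d) (b : Basis (Fin 2) ℚ E) (hb0 : b 0 = 1) (hb1 : b 1 = θ)
    {s : ℝ} {u v : ℚ} (hmix : ((u : ℝ) + v * s) * (u - v * s) < 0) (pos : Bool) :
    ∃ v' : ℚ, (if pos then 0 < (u : ℝ) + v' * s else (u : ℝ) + v' * s < 0) ∧
      Equivalent
        (transfer E ((algebraMap ℚ E u + algebraMap ℚ E v * θ) • (QuadraticMap.sq (R := E))))
        (transfer E ((algebraMap ℚ E u + algebraMap ℚ E v' * θ) • (QuadraticMap.sq (R := E)))) := by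
  rcases lt_or_gt_of_ne (left_ne_zero_of_mul hmix.ne) with hneg | hposv
  · have h2 : 0 < (u : ℝ) - v * s := by nlinarith
    cases pos
    · exact ⟨v, by simpa using hneg, QuadraticMap.Equivalent.refl _⟩
    · refine ⟨-v, ?_, equivalent_transfer_conj hθ b hb0 hb1 u v⟩
      simp only [if_true]
      push_cast
      linarith
  · have h2 : (u : ℝ) - v * s < 0 := by nlinarith
    cases pos
    · refine ⟨-v, ?_, equivalent_transfer_conj hθ b hb0 hb1 u v⟩
      simp only [Bool.false_eq_true, if_false]
      push_cast
      linarith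
    · exact ⟨v, by simpa using hposv, QuadraticMap.Equivalent.refl _⟩

/-- **Bayer-Fluckiger–van Geemen–Schütt 2025, Cor. 11.4** (discharge of the named fact
`BFvGS2025_transfer_realQuadratic_of_det_neg_one`): for a real quadratic field `E`, `m` odd,
`m ≥ 3`, `r₀ ∈ {2, 3}` and a rational form `U ≃ ⟨c⟩` of signature `(3, 2m - 3)` and determinant
`-1`, there are `α₁, …, α_m ∈ E^×` and a real embedding `σ` of `E` with exactly `r₀` of the
`σ(αᵢ)` positive (`W_σ` of signature `(r₀, m - r₀)` for `W = ⟨α⟩`) and `U ≃ T_E(⟨α₁, …, α_m⟩)`.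
See the module docstring for the proof (Meyer's theorem replaces the Witt-group transfer
argument of the source). [cite: BayerFluckigerVanGeemenSchuett2025, Cor. 11.4] -/
theorem BFvGS2025_transfer_realQuadratic_of_det_neg_one_holds :
    BFvGS2025_transfer_realQuadratic_of_det_neg_one := by
  intro E _ _ _ hE m hm h3 r₀ hr V _ _ U c hpos hneg hU hdet
  classical
  -- 1. `E = ℚ(θ)`, `θ² = d`, `σ θ = s > 0`
  obtain ⟨θ, d, b, σ, hθ, hb0, hb1, hd, hd1, hθpos⟩ := exists_sqrt_generator hE
  set s : ℝ := σ θ with hs_def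
  have hsd : s ^ 2 = d := by
    rw [hs_def, pow_two, ← map_mul, hθ]
    exact eq_ratCast (σ.comp (algebraMap ℚ E)) d
  have hσ : ∀ u v : ℚ, σ (algebraMap ℚ E u + algebraMap ℚ E v * θ) = u + v * s :=
    fun u v => embedding_coord σ u v
  -- `m = 2j + 3`
  obtain ⟨j, rfl⟩ : ∃ j, m = 2 * j + 3 := by
    obtain ⟨k, hk⟩ := hm
    exact ⟨k - 1, by omega⟩
  -- 2. the positive and the negative weights; carve `⟨-1, -d⟩` blocks
  have hN : 2 * (2 * j) + 3 = 2 * (2 * j + 3) - 3 := by omega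
  set cneg : Fin (2 * (2 * j) + 3) → ℚ := fun i => c (Sum.inr (Fin.cast hN i)) with hcneg
  set cpos : Fin 3 → ℚ := fun i => c (Sum.inl i) with hcpos
  have hcneg_neg : ∀ i, cneg i < 0 := fun i => hneg _
  have hcpos_pos : ∀ i, 0 < cpos i := fun i => hpos _
  obtain ⟨n, ρ, hn, hρ, hprod, hcarve⟩ := exists_negCarve hd (2 * j) cneg hcneg_neg
  have hsplit : Equivalent (weightedSumSquares ℚ c)
      ((weightedSumSquares ℚ cpos).prod (weightedSumSquares ℚ cneg)) := by
    have h1 : c = Sum.elim cpos (fun i => c (Sum.inr i)) := by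
      ext (i | i) <;> rfl
    have h2 : Equivalent (weightedSumSquares ℚ (fun i => c (Sum.inr i)))
        (weightedSumSquares ℚ cneg) :=
      (equivalent_weightedSumSquares_comp_equiv (fun i => c (Sum.inr i)) (finCongr hN)).symm
    conv_lhs => rw [h1]
    exact (equivalent_weightedSumSquares_sum_elim _ _).trans
      (QuadraticMap.Equivalent.prod (QuadraticMap.Equivalent.refl _) h2)
  -- the determinant: `∏ c₊ ∏ n = -(r / ρ dʲ)²`
  obtain ⟨r, hr'⟩ := hdet
  have hprodc : ∏ i, c i = (∏ i, cpos i) * ∏ i, cneg i := by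
    rw [Fintype.prod_sum_type]
    congr 1
  have hs2 : (∏ i, cpos i) * ∏ i, n i = -(r / (ρ * d ^ j)) ^ 2 := by
    have h1 : (∏ i, cpos i) * ∏ i, cneg i = -(r * r) := by rw [← hprodc, ← hr', neg_neg]
    rw [hprod, pow_mul'] at h1
    have hρd : ρ * d ^ j ≠ 0 := mul_ne_zero hρ (pow_ne_zero _ hd.ne')
    rw [div_pow, neg_div' , eq_div_iff (pow_ne_zero 2 hρd)]
    linear_combination h1
  -- 3. the rank-6 step and the transfer blocks
  obtain ⟨t, x, g, h, ρ', ht, hg, hρ', hNz, hx, hsign0, hsign12, h6⟩ :=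
    exists_three_blocks hd hd1 hcpos_pos hn hs2
  have hblk : ∀ i : Fin 3, Equivalent (weightedSumSquares ℚ ![t i, x i])
      (transfer E ((algebraMap ℚ E (t i / 2) + algebraMap ℚ E (t i * h i / (2 * g i)) * θ) •
        (QuadraticMap.sq (R := E)))) :=
    fun i => equivalent_pair_transfer_smul_sq hθ b hb0 hb1 (ht i) (hg i) (hρ' i) (hx i)
  have hsg := fun i : Fin 3 => transferBlock_signs hd hsd (hg i) (hρ' i) (hx i)
  -- three blocks of mixed sign
  obtain ⟨u₃, v₃, hmix, h6'⟩ : ∃ u₃ v₃ : Fin 3 → ℚ,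
      (∀ i, ((u₃ i : ℝ) + v₃ i * s) * (u₃ i - v₃ i * s) < 0) ∧
      Equivalent ((weightedSumSquares ℚ cpos).prod (weightedSumSquares ℚ n))
        ((transfer E ((algebraMap ℚ E (u₃ 0) + algebraMap ℚ E (v₃ 0) * θ) •
            (QuadraticMap.sq (R := E)))).prod
          ((transfer E ((algebraMap ℚ E (u₃ 1) + algebraMap ℚ E (v₃ 1) * θ) •
              (QuadraticMap.sq (R := E)))).prod
            (transfer E ((algebraMap ℚ E (u₃ 2) + algebraMap ℚ E (v₃ 2) * θ) •
              (QuadraticMap.sq (R := E)))))) := by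
    have h7 := h6.trans (QuadraticMap.Equivalent.prod (hblk 0)
      (QuadraticMap.Equivalent.prod (hblk 1) (hblk 2)))
    rcases hsign12 with ⟨h1, h2⟩ | ⟨ht1, hx1, ht2, hx2⟩
    · exact ⟨fun i => t i / 2, fun i => t i * h i / (2 * g i), fun i => by
        fin_cases i
        · exact (hsg 0).1 hsign0
        · exact (hsg 1).1 h1
        · exact (hsg 2).1 h2, h7⟩
    · obtain ⟨hp1, hm1⟩ := (hsg 1).2.1 ht1 hx1
      obtain ⟨hp2, hm2⟩ := (hsg 2).2.2 ht2 hx2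
      obtain ⟨G, H, G', H', hG, hG', hfix⟩ :=
        exists_mixed_pair hθ b hb0 hb1 σ hs_def.symm hθpos hp1 hm1 hp2 hm2
      refine ⟨![t 0 / 2, G, G'], ![t 0 * h 0 / (2 * g 0), H, H'], fun i => ?_, ?_⟩
      · fin_cases i
        · exact (hsg 0).1 hsign0
        · exact hG
        · exact hG'
      · exact h7.trans (QuadraticMap.Equivalent.prod (QuadraticMap.Equivalent.refl _) hfix)
  -- 4. normalise the signs at `σ`: positive for `i < r₀`
  have hwant : ∀ i : Fin 3, ∃ v' : ℚ,
      (if decide (i.val < r₀) then 0 < (u₃ i : ℝ) + v' * s else (u₃ i : ℝ) + v' * s < 0) ∧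
      Equivalent
        (transfer E ((algebraMap ℚ E (u₃ i) + algebraMap ℚ E (v₃ i) * θ) •
          (QuadraticMap.sq (R := E))))
        (transfer E ((algebraMap ℚ E (u₃ i) + algebraMap ℚ E v' * θ) •
          (QuadraticMap.sq (R := E)))) :=
    fun i => exists_conj_sign hθ b hb0 hb1 (hmix i) _
  choose v' hv' hconj using hwant
  -- the constant block `⟨-1, -d⟩ = T⟨-1/2⟩`
  have hconst : Equivalent (weightedSumSquares ℚ ![(-1 : ℚ), -d])
      (transfer E ((algebraMap ℚ E ((-1 : ℚ) / 2) + algebraMap ℚ E ((-1 : ℚ) * 0 / (2 * 1)) * θ) •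
        (QuadraticMap.sq (R := E)))) :=
    equivalent_pair_transfer_smul_sq hθ b hb0 hb1 (t := -1) (x := -d) (g := 1) (h := 0) (r := 1)
      (by norm_num) one_ne_zero one_ne_zero (by ring)
  -- the family `α`
  set γf : Fin 3 → E := fun i => algebraMap ℚ E (u₃ i) + algebraMap ℚ E (v' i) * θ with hγf
  set βc : E := algebraMap ℚ E ((-1 : ℚ) / 2) + algebraMap ℚ E ((-1 : ℚ) * 0 / (2 * 1)) * θ
    with hβc
  have h3j : 3 + 2 * j = 2 * j + 3 := by omega
  set e : Fin 3 ⊕ Fin (2 * j) ≃ Fin (2 * j + 3) := finSumFinEquiv.trans (finCongr h3j) with he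
  set α : Fin (2 * j + 3) → E := fun k => Sum.elim γf (fun _ => βc) (e.symm k) with hα
  have hσγ : ∀ i, σ (γf i) = u₃ i + v' i * s := fun i => hσ _ _
  have hσβ : σ βc = -1 / 2 := by
    rw [hβc, hσ]; push_cast; ring
  refine ⟨α, σ, ?_, ?_, ?_⟩
  · -- non-vanishing
    intro k
    change Sum.elim γf (fun _ => βc) (e.symm k) ≠ 0
    rcases e.symm k with i | i
    · change γf i ≠ 0
      intro h0
      have := hv' i
      rw [← hσγ, h0, map_zero] at this
      split_ifs at this <;> exact lt_irrefl _ this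
    · change βc ≠ 0
      intro h0
      have := hσβ
      rw [h0, map_zero] at this
      norm_num at this
  · -- counting the positive `σ(αᵢ)`
    have key : ∀ i : Fin 3, (0 < σ (γf i)) ↔ i.val < r₀ := fun i => by
      rw [hσγ]
      have := hv' i
      by_cases hi : i.val < r₀
      · simp only [hi, decide_true, if_true] at this
        exact ⟨fun _ => hi, fun _ => this⟩
      · simp only [hi, decide_false, Bool.false_eq_true, if_false] at this
        exact ⟨fun h' => (lt_asymm h' this).elim, fun h' => absurd h' hi⟩
    have hce : Fintype.card {k : Fin (2 * j + 3) // 0 < σ (α k)} =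
        Fintype.card {y : Fin 3 ⊕ Fin (2 * j) // 0 < σ (Sum.elim γf (fun _ => βc) y)} :=
      Fintype.card_congr (Equiv.subtypeEquiv e.symm fun k => Iff.rfl)
    rw [← Fintype.card_subtype, hce, Fintype.card_subtype, Finset.card_filter,
      Fintype.sum_sum_type]
    simp only [Sum.elim_inl, Sum.elim_inr, hσβ, key]
    rw [Finset.sum_eq_zero (fun (i : Fin (2 * j)) _ => if_neg (by norm_num)), add_zero,
      Fin.sum_univ_three]
    rcases hr with rfl | rfl <;> simp
  · -- the isometry `U ≅ T_E(⟨α⟩)`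
    have hTα : transfer E (weightedSumSquares E α) =
        QuadraticMap.pi ((Sum.elim (fun i => transfer E (γf i • (QuadraticMap.sq (R := E))))
          (fun _ : Fin (2 * j) => transfer E (βc • (QuadraticMap.sq (R := E))))) ∘ e.symm) := by
      rw [transfer_weightedSumSquares_eq_pi]
      congr 1
      ext1 k
      simp only [hα, Function.comp_apply]
      rcases e.symm k with i | i <;> rfl
    rw [hTα]
    refine hU.trans ?_
    refine hsplit.trans ?_
    refine (QuadraticMap.Equivalent.prod (QuadraticMap.Equivalent.refl _) hcarve).trans ?_
    refine (QuadraticMap.Equivalent.prod (QuadraticMap.Equivalent.refl _)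
      ⟨QuadraticMap.IsometryEquiv.prodComm _ _⟩).trans ?_
    refine (equivalent_prod_assoc _ _ _).symm.trans ?_
    refine (QuadraticMap.Equivalent.prod h6'
      (QuadraticMap.Equivalent.pi fun _ : Fin (2 * j) => hconst)).trans ?_
    refine (QuadraticMap.Equivalent.prod
      (QuadraticMap.Equivalent.prod (hconj 0) (QuadraticMap.Equivalent.prod (hconj 1) (hconj 2)))
      (QuadraticMap.Equivalent.refl _)).trans ?_
    refine (QuadraticMap.Equivalent.prod
      (equivalent_prod_prod_pi_fin_three fun i => transfer E (γf i • (QuadraticMap.sq (R := E))))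
      (QuadraticMap.Equivalent.refl _)).trans ?_
    refine (equivalent_pi_sum_elim _ _).symm.trans ?_
    exact (equivalent_pi_comp_equiv _ e.symm).symm

end Literature.NumberTheory.QuadraticForms
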